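import Mathlib
import HarnessLib
import Summits.HubbardSuperconductivity.HubbardSuperconductivity.Theorems.KLProgrammeKLRegimeSectorMultiplierPairDiffsThird
import Summits.HubbardSuperconductivity.HubbardSuperconductivity.Theorems.KLProgrammeKLRegimeSectorMultiplierPairWtRates
import Summits.HubbardSuperconductivity.HubbardSuperconductivity.Theorems.KLProgrammeH10TwoPointLimitSectorMultiplierSupport
import Summits.HubbardSuperconductivity.HubbardSuperconductivity.Theorems.KLProgrammeKLRegimeTorusL1MixedDifferencesMoment

/-!
# Route `KLProgramme` — engine support, route (L2): the UNIFORM WEIGHTED `ℓ¹` bound (one position moment) of the space-time character sum of the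
# thin PAIR `F_{ω₁}F_{ω₂}` (`klAnisoFamily` at NEIGHBOURING scales `n₂ ≤ n₁ ≤ n₂ + 1`) on an admissible frame —
# `Σ_z (1 + s₀|j̃| + s₁|z̃|₁)‖S(z)‖ ≤ √(a·b/e₀)·M·L²` with `s₀ ≍ Λ_{n₁}β/M`, `s₁ ≍ Λ_{n₁}` and ONE constant

Cell `gate-hubbard-kl`, seat p3 (g10); program «W2 = weighted overlap rows» (KL STATUS 2026-08-27 19:05Z), file W2c: the weighted /
mixed-order twin of p4's `charSum_klAnisoPair_le_uniform` (`…SectorMultiplierBound`) — the input `T_w` of the weighted thin × fat reduction and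
of the weighted overlap / re-sectorisation rows `E(klAnisoFamily J′)·S(F̃_k)` (the `cr/cc` binders of `EngineV8.klNormsStepWt_of_sliceConsts`).
Inputs: order THREE (iso) from `…SectorMultiplierPairDiffsThird` + `iso3_pack_pair_le`, order TWO along `v` from p4 (`kx_le`, verbatim);
master `sum_wt_norm_charSum_le_of_mixed_differences`; bookkeeping as in `…SectorMultiplierWtBound`:

  **`charSumWt_klAnisoPair_le_uniform`** — for `n₂ ≤ n₁ ≤ n₂ + 1`, under `Λ_{n₁}β < π(2M−5)`, `βe₀ ≤ M`, `3|2π/L|(2^{n₁}+½) ≤ z`, `2π·16^{n₁} ≤ L`,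
  `π/(4β) ≤ Λ_{n₁}` and `A₃Λ_{n₁}² ≤ a₃`:
  `Σ_z (1 + s₀|j̃| + s₁|z̃₁| + s₁|z̃₂|)·‖Σ_q χχ • (F_{ω₁}F_{ω₂})(k_q)‖ ≤ √(a·b/e₀)·M·L²`,
  `s₀ = 2Λβ/(2Mπκ_t)`, `s₁ = 2Λ/(πκ_c)`, `a = 524288(πκ_t+1)((1+12√2)²/4 + 1/16)κ_X`, `b = (240/π)c_{N,1}c_{N,2}`.

Everything is proved; no definitions, no named facts. [cite: BenfattoGiulianiMastropietro2006, Lemma 2.2 (2.52)–(2.55), §2.6 (2.81), §2.7 (2.71a)]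
-/

noncomputable section

namespace Summit.HubbardSuperconductivity.HubbardSuperconductivity.Theorems.TorusFourierL2

set_option linter.dupNamespace false -- summit = problem name (single-conjunct summit), D-0017

open Set Finset Literature.MathematicalPhysics.QuantumLattice Literature.MathematicalPhysics.QuantumLattice.BandSectorCounting
open Literature.MathematicalPhysics.QuantumLattice.FermiRG Literature.Probability.LatticeModels Literature.Analysis.SpecialFunctions
open Summit.HubbardSuperconductivity.HubbardSuperconductivity.Theorems.DispersionFlow
open Summit.HubbardSuperconductivity.HubbardSuperconductivity.Theorems.KLRegimeSplit
open Summit.HubbardSuperconductivity.HubbardSuperconductivity.Theorems.KLProgrammeLegKernels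
open Summit.HubbardSuperconductivity.HubbardSuperconductivity.Theorems.PerturbedFermiCurve
open scoped Real
section Main
variable {L M : ℕ} [NeZero L] [NeZero M] {a b : ℝ} (B : BandBounds a b) {K : TrigPolyC4v} {A : ℝ}
  (hA : ∀ p : Momentum, ∀ j ≤ 2, ‖iteratedFDeriv ℝ j (frameShift K) p‖ ≤ A) (hADt : 2 * A < B.Dtmin)
  {μ e₀ z β : ℝ} (he : 0 < e₀) (hz : 0 < z) (hz1 : z ≤ 1) (hgap : e₀ + A + z ^ 2 < -μ) (h3 : e₀ + A - μ ≤ 3)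
  (hlo : a ≤ μ - A - e₀) (hhi : μ + A + e₀ ≤ b) (hβ : 0 < β) (hρA : 4 * A < 2 * B.rhomin)
  {n₁ n₂ : ℕ} (hn : n₂ ≤ n₁) (ω₁ : Fin (sectorCount n₁)) (ω₂ : Fin (sectorCount n₂))
  {d : ℝ} (hd : 0 < d) (hd1 : ∀ u, |deriv (bgmCutoffSq e₀) u| ≤ d) (hd2 : ∀ u, |iteratedDeriv 2 (bgmCutoffSq e₀) u| ≤ d)
  (hd3 : ∀ u, |iteratedDeriv 3 (bgmCutoffSq e₀) u| ≤ d)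
  {A₃ a₃ : ℝ} (hA3 : ∀ p : Momentum, ‖iteratedFDeriv ℝ 3 (frameShift K) p‖ ≤ A₃)
  {Z : (Fin 2 → ℝ) → ℝ}
  (hZ : ∀ p, Z p = gnCutoff ((π + z) ^ 2 / π ^ 2) ((π + z) ^ 2) (p 0 ^ 2) * gnCutoff ((π + z) ^ 2 / π ^ 2) ((π + z) ^ 2) (p 1 ^ 2) *
    ((radialCutoffC (1 / 2) (momToComplex p) * sectorWeightCirc n₁ ((ω₁ : ℕ) : ℤ) (polarAngle p)) *
      (radialCutoffC (1 / 2) (momToComplex p) * sectorWeightCirc n₂ ((ω₂ : ℕ) : ℤ) (polarAngle p))))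
  {Φ : ℝ × (Fin 2 → ℝ) → ℂ}
  (hΦ : ∀ k₀ p, Φ (k₀, p) = ((bgmCutoffSq e₀ ((16 : ℝ) ^ n₁ * (k₀ ^ 2 + frameLevel μ K (WithLp.toLp 2 p) ^ 2)) *
      bgmCutoffSq e₀ ((16 : ℝ) ^ n₂ * (k₀ ^ 2 + frameLevel μ K (WithLp.toLp 2 p) ^ 2)) * Z p : ℝ) : ℂ))
  {Gs : TorusSite 1 (2 * M) × TorusSite 2 L → ℂ}
  (hGs : ∀ q, Gs q = klAnisoFamily L M β μ K e₀ n₁ ω₁ (⟨(q.1 0).val, ZMod.val_lt (q.1 0)⟩, q.2) *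
    klAnisoFamily L M β μ K e₀ n₂ ω₂ (⟨(q.1 0).val, ZMod.val_lt (q.1 0)⟩, q.2))
  -- the angular constant of `exists_norm_iteratedDeriv_sectorWeightCirc_polarAngle_line_le 2`
  {Ba : ℝ} (hB0 : 0 < Ba)
  (hB : ∀ (i : ℕ), i ≤ 2 → ∀ (n : ℕ) (ω : ℤ) (θ₀ : ℝ) (q w : Fin 2 → ℝ) (t : ℝ) {r₀ : ℝ}, 0 < r₀ →
    r₀ ≤ ‖momToComplex (q + t • w)‖ → |sectorRelAngle θ₀ (q + t • w)| < π →
    ‖iteratedDeriv i (fun t : ℝ => sectorWeightCirc n ω (polarAngle (q + t • w))) t‖ ≤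
      (2 : ℕ).factorial * Ba * ((1 + (sectorWidth n)⁻¹ * (2 : ℕ).factorial) * ‖momToComplex w‖ / r₀) ^ i)
  -- the angular constant of `exists_norm_iteratedDeriv_sectorWeightCirc_polarAngle_line_le 3`
  {Ba3 : ℝ} (hB30 : 0 < Ba3)
  (hB3 : ∀ (i : ℕ), i ≤ 3 → ∀ (n : ℕ) (ω : ℤ) (θ₀ : ℝ) (q w : Fin 2 → ℝ) (t : ℝ) {r₀ : ℝ}, 0 < r₀ →
    r₀ ≤ ‖momToComplex (q + t • w)‖ → |sectorRelAngle θ₀ (q + t • w)| < π →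
    ‖iteratedDeriv i (fun t : ℝ => sectorWeightCirc n ω (polarAngle (q + t • w))) t‖ ≤
      (3 : ℕ).factorial * Ba3 * ((1 + (sectorWidth n)⁻¹ * (3 : ℕ).factorial) * ‖momToComplex w‖ / r₀) ^ i)
  -- the named constants (parameters with defining equations; instantiate with `rfl`)
  {cG c1 ρb Y κ cT κt κ₃P κc Kc κX cN1 cN2 : ℝ}
  (hcG : cG = 4 * (d * e₀ ^ 4 * 1 + 2 * (d * e₀ ^ 2) * (d * e₀ ^ 2) + 1 * (d * e₀ ^ 4)) + 2 * (d * e₀ ^ 2 * 1 + 1 * (d * e₀ ^ 2)))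
  (hc1 : c1 = d * e₀ ^ 2 * 1 + 1 * (d * e₀ ^ 2))
  (hρb : ρb = (e₀ + 3 * π / 2 * B.smax * B.Dtmin) / (B.Dtmin - 2 * A))
  (hY : Y = (4 + 2 * A) + (4 + 4 * A) * (2 * ρb + 5))
  (hκ : κ = cG * Y ^ 2 + 2 * c1 * (4 + 4 * A) * (9 / 4) * e₀ + 8 * c1 * Ba * Y * 12 * e₀ + 2 * Ba * 72 * e₀ ^ 2 +
    8 * Ba ^ 2 * 36 * e₀ ^ 2)
  (hcT : cT = 8 * (d * e₀ ^ 6 * 1 + 3 * (d * e₀ ^ 4) * (d * e₀ ^ 2) + 3 * (d * e₀ ^ 2) * (d * e₀ ^ 4) + 1 * (d * e₀ ^ 6)) +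
    12 * (d * e₀ ^ 4 * 1 + 2 * (d * e₀ ^ 2) * (d * e₀ ^ 2) + 1 * (d * e₀ ^ 4)))
  (hκt : κt = max 1 cT)
  (hκ₃P : κ₃P = (8 * (d * e₀ ^ 6 * 1 + 3 * (d * e₀ ^ 4) * (d * e₀ ^ 2) + 3 * (d * e₀ ^ 2) * (d * e₀ ^ 4) + 1 * (d * e₀ ^ 6)) +
        12 * (d * e₀ ^ 4 * 1 + 2 * (d * e₀ ^ 2) * (d * e₀ ^ 2) + 1 * (d * e₀ ^ 4))) * (4 + 2 * A) ^ 3 +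
      (12 * (d * e₀ ^ 4 * 1 + 2 * (d * e₀ ^ 2) * (d * e₀ ^ 2) + 1 * (d * e₀ ^ 4)) + 6 * (d * e₀ ^ 2 * 1 + 1 * (d * e₀ ^ 2))) *
        (4 + 2 * A) * (4 + 4 * A) * e₀ + 2 * (d * e₀ ^ 2 * 1 + 1 * (d * e₀ ^ 2)) * (4 * e₀ ^ 2 + 8 * a₃) +
      216 * Ba3 * ((4 * (d * e₀ ^ 4 * 1 + 2 * (d * e₀ ^ 2) * (d * e₀ ^ 2) + 1 * (d * e₀ ^ 4)) + 2 * (d * e₀ ^ 2 * 1 + 1 * (d * e₀ ^ 2))) *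
        (4 + 2 * A) ^ 2 * e₀ + 2 * (d * e₀ ^ 2 * 1 + 1 * (d * e₀ ^ 2)) * (4 + 4 * A) * e₀ ^ 2) +
      (2592 * Ba3 + 15552 * Ba3 ^ 2) * (d * e₀ ^ 2 * 1 + 1 * (d * e₀ ^ 2)) * (4 + 2 * A) * e₀ ^ 2 + (2592 * Ba3 + 46656 * Ba3 ^ 2) * e₀ ^ 3)
  (hκc : κc = max 1 (max κ₃P κ)) (hKc : Kc = κc ^ 2)
  (hκX : κX = 4 * (3 * Real.sqrt 2 * π * Real.sqrt Kc + 2 * e₀) ^ 2 / e₀ +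
    96 / (π * e₀ ^ 2) * ((π * Real.sqrt Kc / 2) * (π * Real.sqrt Kc / 2 + e₀) ^ 2))
  (hcN1 : cN1 = Real.sqrt 2 * (e₀ + (4 + 4 * A) * ρb ^ 2) / ((2 * B.rhomin - 4 * A) * π) + 2)
  (hcN2 : cN2 = 2 * Real.sqrt 2 * ρb / π + 2)

set_option maxHeartbeats 6000000 in -- large explicit constants: elaboration of the symbol-layer bounds and their packaging is slow
include B hA hADt he hz hz1 hgap h3 hlo hhi hβ hρA hn hd hd1 hd2 hd3 hA3 hZ hΦ hGs hB0 hB hB30 hB3 hcG hc1 hρb hY hκ hcT hκt hκ₃P hκc hKc hκX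
  hcN1 hcN2 in
/-- **The uniform WEIGHTED `ℓ¹` bound of the space-time character sum of `F_{ω₁}F_{ω₂}` on an admissible frame** for neighbouring scales
`n₂ ≤ n₁ ≤ n₂ + 1`: `Σ_z (1 + s₀|j̃| + s₁|z̃₁| + s₁|z̃₂|)·‖S(z)‖ ≤ √(a·b/e₀)·M·L²` with `s₀ = 2Λβ/(2Mπκ_t)`, `s₁ = 2Λ/(πκ_c)`, `Λ = Λ_{n₁}` and the
constants of the header — uniform in the scale, the sectors, `β ∈ [π/(4Λ), M/e₀]` and the volume, given the order-three frame datum `A₃Λ² ≤ a₃`.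
[cite: BenfattoGiulianiMastropietro2006, Lemma 2.2 (2.52)–(2.55), §2.6 (2.81), §2.7 (2.71a)] -/
theorem charSumWt_klAnisoPair_le_uniform (hn1 : n₁ ≤ n₂ + 1) (ha3 : A₃ * klScale e₀ n₁ ^ 2 ≤ a₃) (hM : klScale e₀ n₁ * β < π * (2 * M - 5))
    (hMβ : β * e₀ ≤ M) (hLz : 3 * |2 * π / (L : ℝ)| * ((2 : ℝ) ^ n₁ + 1 / 2) ≤ z) (hL16 : 2 * π * (16 : ℝ) ^ n₁ ≤ L)
    (hΛβ : π / (4 * β) ≤ klScale e₀ n₁) :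
    ∑ zz : TorusSite 1 (2 * M) × TorusSite 2 L,
        (1 + 2 * klScale e₀ n₁ * β / (((2 * M : ℕ) : ℝ) * π * Real.sqrt (κt ^ 2)) * |(((zz.1 0).valMinAbs : ℤ) : ℝ)| +
            2 * klScale e₀ n₁ / (π * Real.sqrt Kc) * |(((zz.2 0).valMinAbs : ℤ) : ℝ)| +
            2 * klScale e₀ n₁ / (π * Real.sqrt Kc) * |(((zz.2 1).valMinAbs : ℤ) : ℝ)|) *
          ‖∑ q : TorusSite 1 (2 * M) × TorusSite 2 L, (torusChar q.1 zz.1 * torusChar q.2 zz.2) • Gs q‖ ≤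
      Real.sqrt (524288 * (π * Real.sqrt (κt ^ 2) + 1) * ((1 + 12 * Real.sqrt 2) ^ 2 / 4 + 1 / 16) * κX * (240 / π * (cN1 * cN2)) / e₀) *
        M * (L : ℝ) ^ 2 := by
  classical
  have hL : (0 : ℝ) < L := Nat.cast_pos.2 (Nat.pos_of_ne_zero (NeZero.ne L))
  have hMpos : (0 : ℝ) < M := Nat.cast_pos.2 (Nat.pos_of_ne_zero (NeZero.ne M))
  have hπ := Real.pi_pos
  have hA0 : 0 ≤ A := le_trans (norm_nonneg _) (hA 0 0 (by norm_num))
  have hlo' : a ≤ μ - A := by linarith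
  have hhi' : μ + A ≤ b := by linarith
  have hc : 0 < 2 * π / (L : ℝ) := by positivity
  have habs : |2 * π / (L : ℝ)| = 2 * π / L := abs_of_pos hc
  have hγ : 0 < 2 * B.rhomin - 4 * A := by linarith
  -- the scale bookkeeping: `Λ = e₀ 4^{-n₁}`, `N = 2^{n₁}`, `ΛN² = e₀`
  obtain ⟨hΛN2, hΛe, hΛN, hN2L, hLΛ2, hhN2⟩ := scale_facts he n₁ hL16
  set Λ : ℝ := klScale e₀ n₁ with hΛdef
  set N : ℝ := (2 : ℝ) ^ n₁ with hNdef
  have hΛ : 0 < Λ := by rw [hΛdef, klScale]; positivity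
  have hN1 : 1 ≤ N := one_le_pow₀ (by norm_num)
  have hN0 : 0 < N := by positivity
  -- the steps: `h = 2π/L`, `U = h(N + ½)`
  set U : ℝ := 2 * π / L * (N + 1 / 2) with hUdef
  have hU0 : 0 < U := by positivity
  have hLz3 : 3 * (2 * π / (L : ℝ)) * (N + 1 / 2) ≤ z := by rw [habs] at hLz; exact hLz
  have hLz2 : 2 * |2 * π / (L : ℝ)| * (N + 1 / 2) ≤ z := by
    rw [habs]
    have h0 : 0 ≤ (2 * π / (L : ℝ)) * (N + 1 / 2) := by positivity
    linarith only [hLz3, h0]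
  have hLz' : 2 * (2 * π / (L : ℝ)) * (N + 1 / 2) ≤ z := by rw [habs] at hLz2; exact hLz2
  have hU32 : U ≤ 3 / 2 * (2 * π / (L : ℝ) * N) := by
    rw [hUdef]
    have := mul_le_mul_of_nonneg_left hN1 hc.le
    linarith only [this]
  have hLU : (L : ℝ) * U ≤ 3 * π * N := by
    rw [hUdef]
    have e : (L : ℝ) * (2 * π / L * (N + 1 / 2)) = 2 * π * (N + 1 / 2) := by field_simp
    rw [e]
    have := mul_le_mul_of_nonneg_left hN1 hπ.le
    linarith only [this]
  have hcG0 : 0 < cG := by rw [hcG]; positivity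
  have hc10 : 0 ≤ c1 := by rw [hc1]; positivity
  have hρb0 : 0 ≤ ρb := by rw [hρb]; have := B.smax_pos; have := B.Dtmin_pos; positivity
  have hY0 : 0 ≤ Y := by rw [hY]; positivity
  have hκ0 : 0 < κ := by rw [hκ]; positivity
  have hκX0 : 0 ≤ κX := by rw [hκX]; positivity
  have hcN10 : 0 ≤ cN1 := by rw [hcN1]; positivity
  have hcN20 : 0 ≤ cN2 := by rw [hcN2]; positivity
  have hA30 : 0 ≤ A₃ := le_trans (norm_nonneg _) (hA3 0)
  have ha30 : 0 ≤ a₃ := le_trans (by positivity) ha3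
  have hcT0 : 0 ≤ cT := by rw [hcT]; positivity
  have hκt1 : 1 ≤ κt := by rw [hκt]; exact le_max_left _ _
  have hκtc : cT ≤ κt := by rw [hκt]; exact le_max_right _ _
  have hκt0 : 0 < κt := lt_of_lt_of_le one_pos hκt1
  have hsqt : Real.sqrt (κt ^ 2) = κt := Real.sqrt_sq hκt0.le
  have hcG0' : 0 < κt ^ 2 := by positivity
  have hκ₃P0 : 0 ≤ κ₃P := by rw [hκ₃P]; positivity
  have hκc1 : 1 ≤ κc := by rw [hκc]; exact le_max_left _ _
  have hκc3 : κ₃P ≤ κc := by rw [hκc]; exact (le_max_left _ _).trans (le_max_right _ _)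
  have hκc2 : κ ≤ κc := by rw [hκc]; exact (le_max_right _ _).trans (le_max_right _ _)
  have hκc0 : 0 < κc := lt_of_lt_of_le one_pos hκc1
  have hK0 : 0 < Kc := by rw [hKc]; positivity
  have hsqK : Real.sqrt Kc = κc := by rw [hKc]; exact Real.sqrt_sq hκc0.le
  have hκK : κ ≤ Kc := by rw [hKc]; nlinarith
  -- the cell radius `ρ ≤ ρ̄/N` and the angular factors `Dᵢ ≤ 2N`
  set ρ : ℝ := (klScale e₀ n₁ + B.smax * B.Dtmin * (3 * sectorWidth n₂ / 4)) / (B.Dtmin - 2 * A) with hρdef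
  have hρ0 : 0 ≤ ρ := by
    have := B.smax_pos; have := B.Dtmin_pos; have := sectorWidth_pos n₂; positivity
  have hρN : ρ ≤ ρb / N := by rw [hρdef, hρb]; exact cellRadius_le B hADt hn1 hΛN
  obtain ⟨hD₁, hD₁0⟩ := angularFactor_le (le_refl n₁)
  obtain ⟨hD₂, hD₂0⟩ := angularFactor_le hn
  -- the tangent step
  set eK : (Fin 2 → ℝ) → ℝ := fun p => frameLevel μ K (WithLp.toLp 2 p) with heK
  set pF : Fin 2 → ℝ := klFermiPoint μ K (sectorCenter n₂ (ω₂ : ℕ)) with hpF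
  have hgrad : ‖fderiv ℝ eK pF‖ ≤ 4 + 2 * A := norm_fderiv_frameBand_le hA μ pF
  have hγ' : 0 < Real.sqrt (fderiv ℝ eK pF (Pi.single 0 1) ^ 2 + fderiv ℝ eK pF (Pi.single 1 1) ^ 2) :=
    lt_of_lt_of_le (by linarith) (gradient_floor_klFermiPoint B hA hlo' hhi' (sectorCenter n₂ (ω₂ : ℕ)))
  set v : Fin 2 → ℤ := ![round (N * (-fderiv ℝ eK pF (Pi.single 1 1) /
      Real.sqrt (fderiv ℝ eK pF (Pi.single 0 1) ^ 2 + fderiv ℝ eK pF (Pi.single 1 1) ^ 2))),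
    round (N * (fderiv ℝ eK pF (Pi.single 0 1) /
      Real.sqrt (fderiv ℝ eK pF (Pi.single 0 1) ^ 2 + fderiv ℝ eK pF (Pi.single 1 1) ^ 2)))] with hvdef
  have hv0 : v 0 = round (N * (-fderiv ℝ eK pF (Pi.single 1 1) /
      Real.sqrt (fderiv ℝ eK pF (Pi.single 0 1) ^ 2 + fderiv ℝ eK pF (Pi.single 1 1) ^ 2))) := by
    rw [hvdef]; rfl
  have hv1 : v 1 = round (N * (fderiv ℝ eK pF (Pi.single 0 1) /
      Real.sqrt (fderiv ℝ eK pF (Pi.single 0 1) ^ 2 + fderiv ℝ eK pF (Pi.single 1 1) ^ 2))) := by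
    rw [hvdef]; rfl
  obtain ⟨hτv, hvsize, hv⟩ := tangentStep_bounds eK pF hgrad hγ' hN1 v hv0 hv1 (2 * π / L)
  have hV : N / 2 ≤ Real.sqrt ((v 0 : ℝ) ^ 2 + (v 1 : ℝ) ^ 2) := half_le_norm_tangentStep hγ' n₁ v hv0 hv1 hv
  obtain ⟨hR₀, hR₀'⟩ := tangentR0_bounds hN1 v hv hvsize (twelve_mul_le_of_step hL hN0 hz1 hLz')
  set R₀ : ℕ := (L - 1) / (2 * ((v 0).natAbs + (v 1).natAbs)) with hR₀def
  -- admissibility of the steps (`4π|u_j| ≤ zL`)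
  have huv : ∀ j, 2 * |2 * π / (L : ℝ)| * |(v j : ℝ)| ≤ z := fun j =>
    (mul_le_mul_of_nonneg_left (hvsize j) (by positivity)).trans hLz2
  have huv3 : ∀ j, 3 * |2 * π / (L : ℝ)| * |(v j : ℝ)| ≤ z := fun j =>
    (mul_le_mul_of_nonneg_left (hvsize j) (by positivity)).trans hLz
  have huax3 : ∀ (i j : Fin 2), 3 * |2 * π / (L : ℝ)| * |(((Pi.single i (1 : ℤ) : Fin 2 → ℤ) j : ℤ) : ℝ)| ≤ z := by
    intro i j
    have h1 : |(((Pi.single i (1 : ℤ) : Fin 2 → ℤ) j : ℤ) : ℝ)| ≤ N + 1 / 2 := by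
      have : |(((Pi.single i (1 : ℤ) : Fin 2 → ℤ) j : ℤ) : ℝ)| ≤ 1 := by
        by_cases hj : j = i
        · subst hj; simp
        · simp [hj]
      linarith only [this, hN1]
    exact (mul_le_mul_of_nonneg_left h1 (by positivity)).trans hLz
  have huperp3 : ∀ j, 3 * |2 * π / (L : ℝ)| * |(((![-v 1, v 0] : Fin 2 → ℤ) j : ℤ) : ℝ)| ≤ z := by
    intro j
    fin_cases j
    · simpa [abs_neg] using huv3 1
    · simpa using huv3 0
  have hWv : ‖(fun j : Fin 2 => 2 * π / L * (v j : ℝ))‖ ≤ U := by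
    refine (pi_norm_le_iff_of_nonneg hU0.le).2 fun j => ?_
    rw [Real.norm_eq_abs, abs_mul, habs, hUdef]
    exact mul_le_mul_of_nonneg_left (hvsize j) hc.le
  have hWp : ‖(fun j : Fin 2 => 2 * π / L * (((![-v 1, v 0] : Fin 2 → ℤ) j : ℤ) : ℝ))‖ ≤ U := by
    refine (pi_norm_le_iff_of_nonneg hU0.le).2 fun j => ?_
    rw [Real.norm_eq_abs, abs_mul, habs, hUdef]
    refine mul_le_mul_of_nonneg_left ?_ hc.le
    fin_cases j
    · simpa [abs_neg] using hvsize 1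
    · simpa using hvsize 0
  have hWmv := norm_momToComplex_le_two_mul hU0.le _ hWv
  have hWmp := norm_momToComplex_le_two_mul hU0.le _ hWp
  -- the pointwise bounds in the master lemma's currency
  have hP0 : (0 : ℝ) < ((2 * M : ℕ) : ℝ) := Nat.cast_pos.2 (Nat.pos_of_ne_zero (mul_ne_zero two_ne_zero (NeZero.ne M)))
  -- time, order three
  have h0' : ∀ q, ‖((fwdDiff ((fun _ : Fin 1 => (1 : ZMod (2 * M))), (0 : TorusSite 2 L)))^[3] Gs) q‖ ≤
      1 * (4 / (2 * Λ * β / (((2 * M : ℕ) : ℝ) * π * Real.sqrt (κt ^ 2)) * ((2 * M : ℕ) : ℝ))) ^ 3 := by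
    intro q
    have h := norm_fwdDiff_three_time_klAnisoPair_le hA he hz h3 hβ hn ω₁ ω₂ hd.le hd1 hd2 hd3 hZ hΦ hGs hM q
    refine h.trans ?_
    rw [← hcT]
    exact cu_rate_time_le (by rw [hsqt]; exact hκt1) (by rw [hsqt]; exact hκtc) hΛ hβ hP0
  -- the angular width factors at order three: `1 + 6/w_{nᵢ} ≤ 3N`
  obtain ⟨hE₁, hE₁0⟩ := one_add_six_div_sectorWidth_le n₁
  obtain ⟨hE₂', hE₂0⟩ := one_add_six_div_sectorWidth_le n₂
  have hE₂ : 1 + 6 * (sectorWidth n₂)⁻¹ ≤ 3 * N :=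
    hE₂'.trans (mul_le_mul_of_nonneg_left (pow_le_pow_right₀ (by norm_num) hn) (by norm_num))
  -- the generic isotropic order-three packaging for a step of size `W`
  have hiso : ∀ (u : Fin 2 → ℤ) (W : ℝ), 0 ≤ W → ‖(fun j : Fin 2 => 2 * π / L * (u j : ℝ))‖ ≤ W →
      ‖momToComplex (fun j : Fin 2 => 2 * π / L * (u j : ℝ))‖ ≤ 2 * W → (∀ j, 3 * |2 * π / (L : ℝ)| * |(u j : ℝ)| ≤ z) →
      ∀ q, ‖((fwdDiff ((0 : TorusSite 1 (2 * M)), (fun j => ((u j : ℤ) : ZMod L))))^[3] Gs) q‖ ≤ κ₃P * W ^ 3 / Λ ^ 3 := by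
    intro u W hW0 hWn hWm hu q
    have hraw := norm_fwdDiff_three_space_klAnisoPair_le hA hA3 he hz hz1 hgap h3 hn ω₁ ω₂ hd.le hd1 hd2 hd3 hZ hΦ hGs hB30.le hB3 u hu q
    refine hraw.trans ?_
    rw [hκ₃P]
    exact iso3_pack_pair_le (by positivity) (by positivity) (by positivity) (by positivity) (by positivity) hA30 hB30.le hΛ hN0.le hW0
      (norm_nonneg _) hWn (norm_nonneg _) hWm hE₁0 hE₁ hE₂0 hE₂ hΛe hΛN ha3
  -- axes, order three
  have h1' : ∀ q (i : Fin 2), ‖((fwdDiff ((0 : TorusSite 1 (2 * M)), (Pi.single i (1 : ZMod L) : TorusSite 2 L)))^[3] Gs) q‖ ≤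
      1 * (4 / (2 * Λ / (π * Real.sqrt Kc) * L)) ^ 3 := by
    intro q i
    have h := hiso (Pi.single i 1) (2 * π / L) hc.le (le_of_eq (norms_axisStep L i).1)
      (by rw [(norms_axisStep L i).2]; linarith only [hc]) (huax3 i) q
    rw [axisStep_cast] at h
    refine h.trans ?_
    exact cu_rate_space_le (by rw [hsqK]; exact hκc1) (by rw [hsqK]; exact hκc3) hΛ hL
  -- the normal step, order three
  have h2' : ∀ q, ‖((fwdDiff ((0 : TorusSite 1 (2 * M)), (fun j => ((((![-v 1, v 0] : Fin 2 → ℤ) j : ℤ)) : ZMod L))))^[3] Gs) q‖ ≤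
      1 * (4 / (4 * Λ / (L * U * Real.sqrt Kc) * L)) ^ 3 := by
    intro q
    have h := hiso (![-v 1, v 0]) U hU0.le hWp hWmp huperp3 q
    refine h.trans ?_
    exact cu_rate_perp_le (by rw [hsqK]; exact hκc1) (by rw [hsqK]; exact hκc3) hΛ hL hU0
  -- the tangent step, order three (isotropic rate)
  have h3'' : ∀ q, ‖((fwdDiff ((0 : TorusSite 1 (2 * M)), (fun j => ((v j : ℤ) : ZMod L))))^[3] Gs) q‖ ≤
      1 * (4 / (4 * Λ / (L * U * Real.sqrt Kc) * L)) ^ 3 := by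
    intro q
    have h := hiso v U hU0.le hWv hWmv huv3 q
    refine h.trans ?_
    exact cu_rate_perp_le (by rw [hsqK]; exact hκc1) (by rw [hsqK]; exact hκc3) hΛ hL hU0
  -- the tangent step (`s = h`, tangency `τ₀ = h(4 + 2A)`)
  have h3' : ∀ q, ‖((fwdDiff ((0 : TorusSite 1 (2 * M)), (fun j => ((v j : ℤ) : ZMod L))))^[2] Gs) q‖ ≤
      1 * (4 / (2 * Λ / (π * Real.sqrt Kc) * L)) ^ 2 := by
    intro q
    have hraw := norm_fwdDiff_two_space_klAnisoPair_le B hA hADt he hz hz1 hgap h3 hlo hhi hn ω₁ ω₂ hd.le hd1 hd2 hZ hΦ hGs hB0.le hB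
      v huv hτv q
    refine le_trans ?_ (sq_rate_space_le hK0 hκK hΛ hL)
    refine hraw.trans ?_
    rw [← hcG, ← hc1, ← hρdef, habs]
    set W : ℝ := ‖(fun j : Fin 2 => 2 * π / L * (v j : ℝ))‖ with hWdef
    set Wm : ℝ := ‖momToComplex (fun j : Fin 2 => 2 * π / L * (v j : ℝ))‖ with hWmdef
    have hW0 : 0 ≤ W := norm_nonneg _
    have hWm0 : 0 ≤ Wm := norm_nonneg _
    have hWN : W ≤ 3 / 2 * (2 * π / L * N) := hWv.trans hU32
    have hWmN : Wm ≤ 3 * (2 * π / L * N) := hWmv.trans (by linarith)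
    refine (kx_le (s := 2 * π / L) (Y := Y) (aw := 9 / 4) (ad := 12) (a2 := 72) (a3 := 36) (e₀ := e₀) hcG0.le hc10 hB0.le hA0
      hΛ hρ0 (by positivity) hW0 hWm0 hD₁0 hD₂0 hc.le hY0 ?_ ?_ ?_ ?_ ?_).trans (le_of_eq ?_)
    · rw [hY]
      have h1 : (ρ + 2 * W) * W ≤ 3 / 2 * ρb * (2 * π / L) + 9 / 2 * (2 * π / L) := by
        have hρW : ρ * W ≤ ρb / N * (3 / 2 * (2 * π / L * N)) := mul_le_mul hρN hWN hW0 (by positivity)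
        have e1 : ρb / N * (3 / 2 * (2 * π / L * N)) = 3 / 2 * ρb * (2 * π / L) := by field_simp
        have hW2 : W * W ≤ (3 / 2 * (2 * π / L * N)) * (3 / 2 * (2 * π / L * N)) := mul_le_mul hWN hWN hW0 (by positivity)
        have hhN : (2 * π / L * N) * (2 * π / L * N) ≤ 2 * π / L := by
          have : (2 * π / L * N) * (2 * π / L * N) = 2 * π / L * (2 * π / L * N ^ 2) := by ring
          rw [this]; exact mul_le_of_le_one_right hc.le hhN2
        rw [e1] at hρW
        have hexp : (ρ + 2 * W) * W = ρ * W + 2 * (W * W) := by ring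
        rw [hexp]
        linarith only [hρW, hW2, hhN]
      have h2 : (4 + 4 * A) * (ρ + 2 * W) * W ≤ (4 + 4 * A) * (3 / 2 * ρb * (2 * π / L) + 9 / 2 * (2 * π / L)) := by
        rw [mul_assoc]; exact mul_le_mul_of_nonneg_left h1 (by linarith only [hA0])
      have hρs : 0 ≤ (4 + 4 * A) * (ρb * (2 * π / (L : ℝ))) := by positivity
      have hs0 : 0 ≤ (4 + 4 * A) * (2 * π / (L : ℝ)) := by positivity
      linarith only [h2, hρs, hs0]
    · have hW2 : W ^ 2 ≤ (3 / 2 * (2 * π / L * N)) ^ 2 := pow_le_pow_left₀ hW0 hWN 2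
      calc W ^ 2 * Λ ≤ (3 / 2 * (2 * π / L * N)) ^ 2 * Λ := by gcongr
        _ = 9 / 4 * (2 * π / L) ^ 2 * (Λ * N ^ 2) := by ring
        _ = 9 / 4 * (2 * π / L) ^ 2 * e₀ := by rw [hΛN2]
    · calc ((1 + 2 * (sectorWidth n₁)⁻¹) + (1 + 2 * (sectorWidth n₂)⁻¹)) * Wm * Λ ≤
          (2 * N + 2 * N) * (3 * (2 * π / L * N)) * Λ := by gcongr
        _ = 12 * (2 * π / L) * (Λ * N ^ 2) := by ring
        _ = 12 * (2 * π / L) * e₀ := by rw [hΛN2]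
    · have hsq₁ : (1 + 2 * (sectorWidth n₁)⁻¹) ^ 2 ≤ (2 * N) ^ 2 := pow_le_pow_left₀ hD₁0 hD₁ 2
      have hsq₂ : (1 + 2 * (sectorWidth n₂)⁻¹) ^ 2 ≤ (2 * N) ^ 2 := pow_le_pow_left₀ hD₂0 hD₂ 2
      have hsqW : Wm ^ 2 ≤ (3 * (2 * π / L * N)) ^ 2 := pow_le_pow_left₀ hWm0 hWmN 2
      calc ((1 + 2 * (sectorWidth n₁)⁻¹) ^ 2 + (1 + 2 * (sectorWidth n₂)⁻¹) ^ 2) * Wm ^ 2 * Λ ^ 2 ≤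
          ((2 * N) ^ 2 + (2 * N) ^ 2) * (3 * (2 * π / L * N)) ^ 2 * Λ ^ 2 := by gcongr
        _ = 72 * (2 * π / L) ^ 2 * (Λ * N ^ 2) ^ 2 := by ring
        _ = 72 * (2 * π / L) ^ 2 * e₀ ^ 2 := by rw [hΛN2]
    · have hsqW : Wm ^ 2 ≤ (3 * (2 * π / L * N)) ^ 2 := pow_le_pow_left₀ hWm0 hWmN 2
      calc (1 + 2 * (sectorWidth n₁)⁻¹) * (1 + 2 * (sectorWidth n₂)⁻¹) * Wm ^ 2 * Λ ^ 2 ≤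
          (2 * N) * (2 * N) * (3 * (2 * π / L * N)) ^ 2 * Λ ^ 2 := by gcongr
        _ = 36 * (2 * π / L) ^ 2 * (Λ * N ^ 2) ^ 2 := by ring
        _ = 36 * (2 * π / L) ^ 2 * e₀ ^ 2 := by rw [hΛN2]
    · rw [hκ]; ring
  have hsup := norm_klAnisoPair_le_one hA he hz h3 ω₁ ω₂ hZ hΦ hGs
  have hNs := card_support_klAnisoPair_le B hA hADt he hz hz1 hgap h3 hlo hhi hβ hρA hn ω₁ ω₂ hd.le hd1 hd2 hZ hΦ hGs
  rw [← hρdef] at hNs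
  -- the mixed master lemma at the clean rates
  have hs₀ : 0 < 2 * Λ * β / (((2 * M : ℕ) : ℝ) * π * Real.sqrt (κt ^ 2)) := by rw [hsqt]; positivity
  have hsK : 0 < Real.sqrt Kc := by rw [hsqK]; exact hκc0
  have hs₁ : 0 < 2 * Λ / (π * Real.sqrt Kc) := by positivity
  have hs₂ : 0 < 4 * Λ / (L * U * Real.sqrt Kc) := by positivity
  have main := sum_wt_norm_charSum_le_of_mixed_differences Gs v hv hs₀ hs₁ hs₂ hs₁ hs₂ hR₀ zero_le_one (le_refl _) hsup h0' h1' h2' h3' h3''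
  refine main.trans ?_
  -- the final bookkeeping
  have hP : ((2 * M : ℕ) : ℝ) = 2 * (M : ℝ) := by push_cast; ring
  rw [hP]
  have hΛβM : Λ * β ≤ M := (mul_le_mul_of_nonneg_right hΛe hβ.le).trans (by rw [mul_comm]; exact hMβ)
  have htfac : 1 / (2 * Λ * β / (2 * (M : ℝ) * π * Real.sqrt (κt ^ 2))) + 1 ≤ M / (Λ * β) * (π * Real.sqrt (κt ^ 2) + 1) :=
    tfac_le hcG0' hΛ hβ hMpos hΛβM
  have hnear2 := near_perp_le (V := Real.sqrt ((v 0 : ℝ) ^ 2 + (v 1 : ℝ) ^ 2)) hK0 hΛ hL hU0 hN0 hV hLU hΛe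
  have hnear3 := near_tan_le (V := Real.sqrt ((v 0 : ℝ) ^ 2 + (v 1 : ℝ) ^ 2)) hK0 hΛ hN0 hV hΛN
  have hfar := far_le (R₀ := (R₀ : ℝ)) hK0 hΛ hL hN0 he hΛe hR₀' hLΛ2
  have hn2 : 0 ≤ 2 * Real.sqrt 2 / (4 * Λ / (L * U * Real.sqrt Kc) * Real.sqrt ((v 0 : ℝ) ^ 2 + (v 1 : ℝ) ^ 2)) + 2 := by positivity
  have hn3 : 0 ≤ 2 * Real.sqrt 2 / (2 * Λ / (π * Real.sqrt Kc) * Real.sqrt ((v 0 : ℝ) ^ 2 + (v 1 : ℝ) ^ 2)) + 2 := by positivity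
  have hbr := bracket_le hΛ hN0 hΛN2 hn3 hnear2 hnear3 hfar
  rw [← hκX] at hbr
  -- the moment constant
  have hV0 : 0 < Real.sqrt ((v 0 : ℝ) ^ 2 + (v 1 : ℝ) ^ 2) := lt_of_lt_of_le (by positivity) hV
  have hratio := cw_ratio_le (V := Real.sqrt ((v 0 : ℝ) ^ 2 + (v 1 : ℝ) ^ 2)) hsK hΛ hL hU0 hN0 hV hLU
  have hCw : 1 + 2 * Real.sqrt 2 * (2 * Λ / (π * Real.sqrt Kc)) / (4 * Λ / (L * U * Real.sqrt Kc) * Real.sqrt ((v 0 : ℝ) ^ 2 + (v 1 : ℝ) ^ 2)) +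
      2 * Real.sqrt 2 * (2 * Λ / (π * Real.sqrt Kc)) / (4 * Λ / (L * U * Real.sqrt Kc) * Real.sqrt ((v 0 : ℝ) ^ 2 + (v 1 : ℝ) ^ 2)) ≤
      1 + 12 * Real.sqrt 2 := by linarith only [hratio]
  have hCw0 : 0 ≤ 1 + 2 * Real.sqrt 2 * (2 * Λ / (π * Real.sqrt Kc)) / (4 * Λ / (L * U * Real.sqrt Kc) * Real.sqrt ((v 0 : ℝ) ^ 2 + (v 1 : ℝ) ^ 2)) +
      2 * Real.sqrt 2 * (2 * Λ / (π * Real.sqrt Kc)) / (4 * Λ / (L * U * Real.sqrt Kc) * Real.sqrt ((v 0 : ℝ) ^ 2 + (v 1 : ℝ) ^ 2)) := by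
    positivity
  have hfr0 : 0 ≤ 16 * (1 / (2 * Λ / (π * Real.sqrt Kc)) + 1) ^ 2 / (1 + 2 * Λ / (π * Real.sqrt Kc) * (R₀ : ℝ)) := by positivity
  have hbrW := bracketWt_le (C₀ := 1 + 12 * Real.sqrt 2) hCw0 hCw hn2 hn3 hfr0
  have hX1 : 524288 * (1 / (2 * Λ * β / (2 * (M : ℝ) * π * Real.sqrt (κt ^ 2))) + 1) *
      ((1 + 2 * Real.sqrt 2 * (2 * Λ / (π * Real.sqrt Kc)) / (4 * Λ / (L * U * Real.sqrt Kc) * Real.sqrt ((v 0 : ℝ) ^ 2 + (v 1 : ℝ) ^ 2)) +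
          2 * Real.sqrt 2 * (2 * Λ / (π * Real.sqrt Kc)) / (4 * Λ / (L * U * Real.sqrt Kc) * Real.sqrt ((v 0 : ℝ) ^ 2 + (v 1 : ℝ) ^ 2))) ^ 2 *
        ((2 * Real.sqrt 2 / (4 * Λ / (L * U * Real.sqrt Kc) * Real.sqrt ((v 0 : ℝ) ^ 2 + (v 1 : ℝ) ^ 2)) + 2) *
          (2 * Real.sqrt 2 / (2 * Λ / (π * Real.sqrt Kc) * Real.sqrt ((v 0 : ℝ) ^ 2 + (v 1 : ℝ) ^ 2)) + 2)) +
        (1 / (2 * Λ / (π * Real.sqrt Kc)) + 1) ^ 2 / (1 + 2 * Λ / (π * Real.sqrt Kc) * (R₀ : ℝ))) ≤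
      524288 * (π * Real.sqrt (κt ^ 2) + 1) * ((1 + 12 * Real.sqrt 2) ^ 2 / 4 + 1 / 16) * κX * (M / (Λ * β)) * (N / Λ) := by
    have hfr16 : (1 / (2 * Λ / (π * Real.sqrt Kc)) + 1) ^ 2 / (1 + 2 * Λ / (π * Real.sqrt Kc) * (R₀ : ℝ)) =
        (16 * (1 / (2 * Λ / (π * Real.sqrt Kc)) + 1) ^ 2 / (1 + 2 * Λ / (π * Real.sqrt Kc) * (R₀ : ℝ))) / 16 := by ring
    rw [hfr16]
    have hbr2 := hbrW.trans (mul_le_mul_of_nonneg_left hbr (by positivity))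
    calc _ ≤ 524288 * (M / (Λ * β) * (π * Real.sqrt (κt ^ 2) + 1)) * (((1 + 12 * Real.sqrt 2) ^ 2 / 4 + 1 / 16) * (N / Λ * κX)) := by
          gcongr
      _ = _ := by ring
  have hsupp := supp_le (K₂ := 4 + 4 * A) (γ := 2 * B.rhomin - 4 * A) hΛ hβ hL hN1 hρ0 hρN (by linarith) hγ hΛN2 hN2L hΛβ
  rw [← hcN1, ← hcN2] at hsupp
  have hX2 : 24 * (2 * (M : ℝ)) * (L : ℝ) ^ 2 *
      ((((univ : Finset (TorusSite 1 (2 * M) × TorusSite 2 L)).filter fun q => Gs q ≠ 0).card : ℕ) : ℝ) ≤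
      240 / π * (cN1 * cN2) * M * (Λ * β) * ((L : ℝ) ^ 2 * ((L : ℝ) ^ 2 / N ^ 3)) := by
    calc _ ≤ 24 * (2 * (M : ℝ)) * (L : ℝ) ^ 2 * (5 * Λ * β / π * ((L : ℝ) ^ 2 / N ^ 3) * (cN1 * cN2)) := by
          gcongr; exact hNs.trans hsupp
      _ = 240 / π * (cN1 * cN2) * M * (Λ * β) * ((L : ℝ) ^ 2 * ((L : ℝ) ^ 2 / N ^ 3)) := by ring
  exact sqrt_mul_sqrt_le (a := 524288 * (π * Real.sqrt (κt ^ 2) + 1) * ((1 + 12 * Real.sqrt 2) ^ 2 / 4 + 1 / 16) * κX)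
    (b := 240 / π * (cN1 * cN2)) (N := N) (Λ := Λ) (β := β)
    (by positivity) (by positivity) (by positivity) (by positivity) hMpos.le hΛ hβ hN0 hΛN2 hX1 hX2

end Main

end Summit.HubbardSuperconductivity.HubbardSuperconductivity.Theorems.TorusFourierL2

end
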